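import Summits.HubbardSuperconductivity.HubbardSuperconductivity.Theorems.LogColdTorusLogColdDWaveOrderSectorPairDecay
import Summits.HubbardSuperconductivity.HubbardSuperconductivity.Theorems.KkBandLift.Negative.BlockGibbsBudget
import Literature.MathematicalPhysics.QuantumLattice.HubbardRingPerronFrobeniusProofs
import Literature.MathematicalPhysics.QuantumLattice.LatticeToriLROProofs
import HarnessLib

/-!
# Route `KkFloor`, crux `KkBandLift` (stmt-HubbardSuperconductivity-10402), NEGATIVE side:
# the thermal-shell witness (Koma–Tasaki canonical-sector Gibbs witness, constructed in Lean)

Refuter's supporting lemma for the refutation of `KkBandLift` (and, through the proved glue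
`KkShelfGivesBand` / `KkWindowGivesBand`, of `KkZenoShelf` and `KkSusceptibilityWindow`): the
hypothesis `ThermalShellWitness U δ` of the strategist's kernel-checked composition
`not_kkBandLift_of : FiniteXFloor → (∀ U δ, 0 < U → δ ∈ Ioo 0 ½ → ThermalShellWitness U δ) → ¬ KkBandLift`
(`Cruxes/KkBandLift/StrategistNegation.lean`), proved here for EVERY `U : ℝ` and every `δ ≥ -1`,
with the statement inlined (no definitions in this file; the generic block / Gibbs-budget lemmas are
in `Negative/BlockGibbsBudget.lean`):

* `thermalShellWitness` — `∀ c > 0, ∃ L₁, ∀ L ≥ L₁, ∃ φ ∈ szSector (2⌊(1-δ)L²/2⌋) 0`, `‖φ‖ = 1`,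
  `Re⟨φ, H_L φ⟩ ≤ minEnergyOn H_L (sector) + cL²`, `Re⟨φ, Δ_d†Δ_d φ⟩ ≤ cL⁴`
  (`H_L = hubbardTorus 2 L 1 U`); `thermalShellWitness_of_mem_Ioo` — the route's doping range.

The witness is the extension by zero of a normalised ground vector of
`X = (H_p - E₀(H_p))/(cL²) + (Δ_d†Δ_d)_p/(cL⁴)`, `M_p = M.toBlock p p` the compression to the
`(n↑, n↓)` occupation block, whose ground energy is at most its expectation `≤ 1` in the Gibbs state
of `H_p` at `β = 4/c`: the ENERGY budget is the entropy bound `Re ω_β(H_p) ≤ E₀(H_p) + log(dim)/β`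
(`Matrix.IsHermitian.gibbsEntropy_le_log_card`, `exp_neg_mul_groundEnergy_le_partitionFn`,
`dim ≤ 2^{2L²}`), the PAIR budget is the tree's canonical-sector Koma–Tasaki bound
`norm_gibbsState_toBlock_hubbardTorus_localPairCorr_le` (Theorems/LogColdTorus…SectorPairDecay)
summed over `Δ_d†Δ_d = Σ_{x,y} (P_x)†P_y` and made `o(L⁴)` by
`Literature.Barriers.HubbardSuperconductivity.tendsto_normalizedSum_zero_of_abs_le_rpow`, and
`E₀(H_p) ≤ minEnergyOn H (szSector (2n) 0)` because sector vectors are supported in the block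
(`mem_szSector_two_mul_zero_iff`). HONEST FRAMING: this is a kernel-checked THEOREM feeding a
decidable verdict (refutation) on route items 10402–10404; it is not summit progress.

Sources: T. Koma, H. Tasaki, Phys. Rev. Lett. 68 (1992) 3248 = arXiv:cond-mat/9709068, Theorem
(eq. (2)), canonical average eq. (3), footnote [10], p. 3 (no LRO at any `T > 0`, any filling).
No definitions.
-/

-- the mandated namespace `Summit.<Summit>.<Problem>.Theorems…` repeats `HubbardSuperconductivity`
-- (single-problem summit, D-0017), which the `dupNamespace` linter flags on every declaration
set_option linter.dupNamespace false

noncomputable section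

namespace Summit.HubbardSuperconductivity.HubbardSuperconductivity.Theorems.KkBandLift.Negative

open Matrix Finset Filter Topology
open Literature.MathematicalPhysics.QuantumLattice Literature.Probability.LatticeModels
  Literature.Barriers.HubbardSuperconductivity
  Summit.HubbardSuperconductivity.HubbardSuperconductivity.Theorems
  Summit.HubbardSuperconductivity.HubbardSuperconductivity.Theorems.LogColdTorus
open scoped ComplexOrder

/-! ### The Hubbard torus compressed to an occupation block -/

section Hubbard

open scoped Classical

/-- **Koma–Tasaki in the block, summed**: for the Gibbs state of the pure Hubbard Hamiltonian
compressed to ANY occupation block `p` (non-empty), the compressed pair intensity obeys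
`Re ω^p_β((Δ_g† Δ_g).toBlock p p) ≤ Σ_{x,y} C_g (dist(x,y)+1)^{-f(β|t|)}` — the canonical-sector
Koma–Tasaki bound `norm_gibbsState_toBlock_hubbardTorus_localPairCorr_le` summed over the
bilinear expansion `Δ_g† Δ_g = Σ_{x,y} (P_x)† P_y`.
[cite: KomaTasakiPRL1992, Theorem eq. (2), eq. (3) and footnote [10]] -/
theorem re_gibbsState_toBlock_pairIntensity_le (L : ℕ) [NeZero L] (g : Site 2 → ℝ) (t U : ℝ)
    {β : ℝ} (hβ : 0 ≤ β) (p : Finset (Orb (FermionTorus 2 L)) → Prop) [DecidablePred p]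
    [Nonempty {s // p s}] :
    (gibbsState β ((hubbardTorus 2 L t U).toBlock p p)
        (((pairField g L)ᴴ * pairField g L).toBlock p p)).re ≤
      ∑ x : TorusSite 2 L, ∑ y : TorusSite 2 L,
        pairFieldDecayConst g * ((torusDist x y : ℝ) + 1) ^ (-pairDecayExponent (β * |t|)) := by
  have hexp : ((pairField g L)ᴴ * pairField g L).toBlock p p =
      ∑ x : TorusSite 2 L, ∑ y : TorusSite 2 L,
        ((localPair g L x)ᴴ * localPair g L y).toBlock p p := by
    rw [pairField, conjTranspose_sum, Finset.sum_mul_sum, toBlock_sum]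
    exact Finset.sum_congr rfl fun x _ => toBlock_sum _ _ _ _
  rw [hexp, map_sum, Complex.re_sum]
  refine Finset.sum_le_sum fun x _ => ?_
  rw [map_sum, Complex.re_sum]
  refine Finset.sum_le_sum fun y _ => ?_
  exact (Complex.re_le_norm _).trans
    (norm_gibbsState_toBlock_hubbardTorus_localPairCorr_le g t U hβ p x y)

/-- **Power-law kernels are `o(L⁴)` on the two-dimensional torus**: for `C ≥ 0`, `f > 0` and every
`ε > 0`, `Σ_{x,y ∈ (ℤ/Lℤ)²} C (dist(x,y)+1)^{-f} ≤ ε L⁴` for all large `L`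
(`tendsto_normalizedSum_zero_of_abs_le_rpow`). [folklore] -/
theorem eventually_sum_rpow_torusDist_le {C f : ℝ} (hC : 0 ≤ C) (hf : 0 < f) {ε : ℝ}
    (hε : 0 < ε) :
    ∃ L₁ : ℕ, ∀ (L : ℕ) [NeZero L], L₁ ≤ L →
      ∑ x : TorusSite 2 L, ∑ y : TorusSite 2 L, C * ((torusDist x y : ℝ) + 1) ^ (-f) ≤
        ε * (L : ℝ) ^ 4 := by
  set G : (L : ℕ) → TorusSite 2 L → TorusSite 2 L → ℝ :=
    fun L x y => C * ((torusDist x y : ℝ) + 1) ^ (-f) with hG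
  have hGb : ∀ (L : ℕ) [NeZero L] (x y : TorusSite 2 L),
      |G L x y| ≤ C * ((torusDist x y : ℝ) + 1) ^ (-f) := by
    intro L _ x y
    rw [hG, abs_of_nonneg (mul_nonneg hC (Real.rpow_nonneg (by positivity) _))]
  have ht := tendsto_normalizedSum_zero_of_abs_le_rpow (d := 2) two_ne_zero hf hGb
  rw [Metric.tendsto_atTop] at ht
  obtain ⟨N, hN⟩ := ht ε hε
  refine ⟨N, fun L _ hL => ?_⟩
  have h := hN L hL
  rw [Real.dist_eq, sub_zero] at h
  have hsum : ∑ x ∈ halfOpenBox 2 L, ∑ y ∈ halfOpenBox 2 L, torusPullback G L x y =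
      ∑ x : TorusSite 2 L, ∑ y : TorusSite 2 L, G L x y :=
    sum_sq_halfOpenBox_comp_torusProj (G L)
  rw [hsum, card_halfOpenBox_sq_real] at h
  have hL4 : (0 : ℝ) < (L : ℝ) ^ (2 * 2) := by
    have := NeZero.ne L
    positivity
  have h2 := (abs_lt.mp h).2
  rw [div_lt_iff₀ hL4, show (L : ℝ) ^ (2 * 2) = (L : ℝ) ^ 4 by norm_num] at h2
  exact h2.le

variable {L : ℕ}

/-- The `(n↑, n↓)` occupation block of the torus of side `L` is non-empty for `n ≤ L²`
(the configuration `α↑ ∪ α↓`, `|α| = n`). [folklore] -/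
theorem nonempty_sectorBlock (n : ℕ) (hn : n ≤ L ^ 2) :
    Nonempty {s : Finset (Orb (FermionTorus 2 L)) // (upPart s).card = n ∧ (downPart s).card = n} := by
  obtain ⟨α, -, hα⟩ := Finset.exists_subset_card_eq
    (s := (Finset.univ : Finset (FermionTorus 2 L))) (n := n)
    (by rw [Finset.card_univ]; simpa [FermionTorus, Fintype.card_lex, Fintype.card_fin] using hn)
  exact ⟨⟨pairSet α α, by simp [hα]⟩⟩

/-- **The block ground energy is below the sector energy**: for `n ≤ L²`, the ground energy of
the Hubbard Hamiltonian compressed to the `(n↑, n↓)` block is at most its lowest energy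
`minEnergyOn` on the joint sector `(N, S^z) = (2n, 0)` (every unit vector of the sector is
supported in the block, where its energy is a Rayleigh quotient of the compression). [folklore] -/
theorem groundEnergy_toBlock_le_minEnergyOn [NeZero L] (t U : ℝ) (n : ℕ) (hn : n ≤ L ^ 2) :
    ((hubbardTorus 2 L t U).toBlock (fun s => (upPart s).card = n ∧ (downPart s).card = n)
        (fun s => (upPart s).card = n ∧ (downPart s).card = n)).groundEnergy ≤
      (hubbardTorus 2 L t U).minEnergyOn (szSector (Λ := FermionTorus 2 L) (2 * n) 0) := by
  set p : Finset (Orb (FermionTorus 2 L)) → Prop :=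
    fun s => (upPart s).card = n ∧ (downPart s).card = n with hp
  haveI : Nonempty {s // p s} := nonempty_sectorBlock n hn
  have hH := hubbardTorus_isHermitian (hamiltonian_isHermitian_and_commute_holds _) t U (d := 2) (L := L)
  have hHp : ((hubbardTorus 2 L t U).toBlock p p).IsHermitian := isHermitian_toBlock p hH
  refine le_csInf ?_ ?_
  · obtain ⟨v, hv1, -⟩ := exists_unit_rayleigh_eq_groundEnergy hHp
    refine ⟨_, Function.extend Subtype.val v 0, ?_, ?_, rfl⟩
    · exact (mem_szSector_two_mul_zero_iff n _).2 fun s hs => extend_val_apply_of_not p v s hs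
    · rw [star_dotProduct_extend, hv1]
  · rintro E ⟨ψ, hψK, hψ1, rfl⟩
    have hψ0 : ∀ s, ¬ p s → ψ s = 0 := (mem_szSector_two_mul_zero_iff n ψ).1 hψK
    rw [star_dotProduct_mulVec_eq_toBlock p _ ψ hψ0]
    refine groundEnergy_le_rayleigh_holds hHp _ ?_
    rw [← star_dotProduct_eq_toBlock p ψ hψ0, hψ1]

/-- `log` of the dimension of an occupation block of the torus of side `L` is at most `2L²`
(`dim ≤ 2^{2L²}`, `log 2 ≤ 1`). [folklore] -/
theorem log_card_block_le (p : Finset (Orb (FermionTorus 2 L)) → Prop) [DecidablePred p]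
    [Nonempty {s // p s}] :
    Real.log (Fintype.card {s // p s}) ≤ 2 * (L : ℝ) ^ 2 := by
  have hc1 : Fintype.card {s // p s} ≤ 2 ^ (2 * L ^ 2) := by
    calc Fintype.card {s // p s} ≤ Fintype.card (Finset (Orb (FermionTorus 2 L))) :=
          Fintype.card_subtype_le _
      _ = 2 ^ (2 * L ^ 2) := by
          rw [Fintype.card_finset, card_orb]
          simp [FermionTorus, Fintype.card_lex, Fintype.card_fin]
  have hc2 : (Fintype.card {s // p s} : ℝ) ≤ (2 : ℝ) ^ (2 * L ^ 2) := by exact_mod_cast hc1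
  have hpos : (0 : ℝ) < Fintype.card {s // p s} := by exact_mod_cast Fintype.card_pos
  calc Real.log (Fintype.card {s // p s}) ≤ Real.log ((2 : ℝ) ^ (2 * L ^ 2)) :=
        Real.log_le_log hpos hc2
    _ = ((2 * L ^ 2 : ℕ) : ℝ) * Real.log 2 := by rw [Real.log_pow]
    _ ≤ ((2 * L ^ 2 : ℕ) : ℝ) * 1 := by
        gcongr
        exact Real.log_two_lt_d9.le.trans (by norm_num)
    _ = 2 * (L : ℝ) ^ 2 := by push_cast; ring

end Hubbard

/-! ### The thermal-shell witness -/

section Witness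

open scoped Classical

/-- **The thermal-shell witness (universal softness of the `d`-wave pair field at positive energy
density).** For every coupling `U`, every `δ ≥ -1` (so that the sector `N↑ = N↓ = ⌊(1-δ)L²/2⌋ ≤ L²`
is non-empty) and every `c > 0` there is `L₁` such that for every side `L ≥ L₁` some UNIT VECTOR
`φ` of the joint sector `(N, S^z) = (2⌊(1-δ)L²/2⌋, 0)` of the Hubbard torus `(ℤ/Lℤ)²` (`t = 1`)
has energy `Re⟨φ, H φ⟩ ≤ E₀(sector) + c L²` and `d`-wave pair intensity
`Re⟨φ, Δ_d† Δ_d φ⟩ ≤ c L⁴`. Proof: the Gibbs state at `β = 4/c` of `H` compressed to the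
`(n↑, n↓)` block has energy `≤ E₀ + log(dim)/β ≤ E₀ + cL²/2` (entropy bound) and, by the
canonical-sector Koma–Tasaki bound summed over `x, y`, pair intensity
`≤ Σ_{x,y} C_d (dist+1)^{-f(β)} ≤ cL⁴/2` for `L ≥ L₁`; a normalised ground vector of
`(H_p - E₀)/(cL²) + (Δ_d†Δ_d)_p/(cL⁴)` then meets both budgets, and its extension by zero is the
witness. This is exactly the hypothesis `ThermalShellWitness U δ` (all `c`) of the strategist's
kernel-checked `not_kkBandLift_of` (Cruxes/KkBandLift/StrategistNegation.lean).
[cite: KomaTasakiPRL1992, Theorem eq. (2), eq. (3), footnote [10] and p. 3] -/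
theorem thermalShellWitness (U δ : ℝ) (hδ : -1 ≤ δ) (c : ℝ) (hc : 0 < c) :
    ∃ L₁ : ℕ, ∀ (L : ℕ) [NeZero L], L₁ ≤ L →
      ∃ φ : Fock (Orb (FermionTorus 2 L)),
        φ ∈ szSector (Λ := FermionTorus 2 L) (2 * ⌊(1 - δ) * (L : ℝ) ^ 2 / 2⌋₊) 0 ∧
        star φ ⬝ᵥ φ = 1 ∧
        (star φ ⬝ᵥ hubbardTorus 2 L 1 U *ᵥ φ).re ≤
          (hubbardTorus 2 L 1 U).minEnergyOn
            (szSector (Λ := FermionTorus 2 L) (2 * ⌊(1 - δ) * (L : ℝ) ^ 2 / 2⌋₊) 0) +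
            c * (L : ℝ) ^ 2 ∧
        (star φ ⬝ᵥ ((pairField dWaveFormFactor L)ᴴ * pairField dWaveFormFactor L) *ᵥ φ).re ≤
          c * (L : ℝ) ^ 4 := by
  set β : ℝ := 4 / c with hβdef
  have hβ : 0 < β := by positivity
  obtain ⟨L₁, hL₁⟩ := eventually_sum_rpow_torusDist_le (pairFieldDecayConst_nonneg dWaveFormFactor)
    (pairDecayExponent_pos (b := β * |(1 : ℝ)|) (by positivity)) (half_pos hc)
  refine ⟨L₁, fun L _ hL => ?_⟩
  set n : ℕ := ⌊(1 - δ) * (L : ℝ) ^ 2 / 2⌋₊ with hn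
  have hnL : n ≤ L ^ 2 := by
    rw [hn]
    refine Nat.floor_le_of_le ?_
    have h1 : (1 - δ) * (L : ℝ) ^ 2 / 2 ≤ (L : ℝ) ^ 2 := by nlinarith [sq_nonneg (L : ℝ)]
    exact_mod_cast h1
  set p : Finset (Orb (FermionTorus 2 L)) → Prop :=
    fun s => (upPart s).card = n ∧ (downPart s).card = n with hp
  haveI : Nonempty {s // p s} := nonempty_sectorBlock n hnL
  set H := hubbardTorus 2 L 1 U with hH
  set Q := (pairField dWaveFormFactor L)ᴴ * pairField dWaveFormFactor L with hQ
  have hHh : H.IsHermitian :=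
    hubbardTorus_isHermitian (hamiltonian_isHermitian_and_commute_holds _) 1 U
  have hHp : (H.toBlock p p).IsHermitian := isHermitian_toBlock p hHh
  have hQp : (Q.toBlock p p).PosSemidef :=
    posSemidef_toBlock p (pairField_conjTranspose_mul_self_posSemidef _ L)
  have hL0 : (0 : ℝ) < L := by exact_mod_cast Nat.pos_of_ne_zero (NeZero.ne L)
  have ha : 0 < c * (L : ℝ) ^ 2 := by positivity
  have hb : 0 < c * (L : ℝ) ^ 4 := by positivity
  -- energy budget of the block Gibbs state
  have hE : (gibbsState β (H.toBlock p p) (H.toBlock p p)).re - (H.toBlock p p).groundEnergy ≤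
      c * (L : ℝ) ^ 2 / 2 := by
    have h1 := re_gibbsState_self_le hHp hβ
    have h2 := log_card_block_le (L := L) p
    have h3 : Real.log (Fintype.card {s // p s}) / β ≤ c * (L : ℝ) ^ 2 / 2 := by
      rw [div_le_iff₀ hβ, hβdef]
      have : c * (L : ℝ) ^ 2 / 2 * (4 / c) = 2 * (L : ℝ) ^ 2 := by
        field_simp
        ring
      rw [this]
      exact h2
    linarith
  -- pair-intensity budget of the block Gibbs state (Koma–Tasaki)
  have hP : (gibbsState β (H.toBlock p p) (Q.toBlock p p)).re ≤ c * (L : ℝ) ^ 4 / 2 := by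
    refine (re_gibbsState_toBlock_pairIntensity_le L dWaveFormFactor 1 U hβ.le p).trans ?_
    have := hL₁ L hL
    linarith
  have hbudget : ((gibbsState β (H.toBlock p p) (H.toBlock p p)).re -
        (H.toBlock p p).groundEnergy) / (c * (L : ℝ) ^ 2) +
      (gibbsState β (H.toBlock p p) (Q.toBlock p p)).re / (c * (L : ℝ) ^ 4) ≤ 1 := by
    have h1 : ((gibbsState β (H.toBlock p p) (H.toBlock p p)).re -
        (H.toBlock p p).groundEnergy) / (c * (L : ℝ) ^ 2) ≤ 1 / 2 := by
      rw [div_le_iff₀ ha]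
      linarith
    have h2 : (gibbsState β (H.toBlock p p) (Q.toBlock p p)).re / (c * (L : ℝ) ^ 4) ≤ 1 / 2 := by
      rw [div_le_iff₀ hb]
      linarith
    linarith
  obtain ⟨v, hv1, hvH, hvQ⟩ := exists_unit_of_gibbs_budget hHp hHp hQp β ha hb hbudget
  refine ⟨Function.extend Subtype.val v 0, ?_, ?_, ?_, ?_⟩
  · exact (mem_szSector_two_mul_zero_iff n _).2 fun s hs => extend_val_apply_of_not p v s hs
  · rw [star_dotProduct_extend, hv1]
  · rw [star_dotProduct_mulVec_extend]
    have := groundEnergy_toBlock_le_minEnergyOn (L := L) 1 U n hnL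
    linarith
  · rw [star_dotProduct_mulVec_extend]
    exact hvQ

/-- The witness in the doping range of the route `KkFloor` (`δ ∈ (0, ½)`), every `U`: the
shape `∀ U δ, 0 < U → δ ∈ Ioo 0 ½ → ThermalShellWitness U δ` consumed by `not_kkBandLift_of`.
[cite: KomaTasakiPRL1992, p. 3] -/
theorem thermalShellWitness_of_mem_Ioo (U δ : ℝ) (hδ : δ ∈ Set.Ioo (0 : ℝ) (1 / 2)) (c : ℝ)
    (hc : 0 < c) :
    ∃ L₁ : ℕ, ∀ (L : ℕ) [NeZero L], L₁ ≤ L →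
      ∃ φ : Fock (Orb (FermionTorus 2 L)),
        φ ∈ szSector (Λ := FermionTorus 2 L) (2 * ⌊(1 - δ) * (L : ℝ) ^ 2 / 2⌋₊) 0 ∧
        star φ ⬝ᵥ φ = 1 ∧
        (star φ ⬝ᵥ hubbardTorus 2 L 1 U *ᵥ φ).re ≤
          (hubbardTorus 2 L 1 U).minEnergyOn
            (szSector (Λ := FermionTorus 2 L) (2 * ⌊(1 - δ) * (L : ℝ) ^ 2 / 2⌋₊) 0) +
            c * (L : ℝ) ^ 2 ∧
        (star φ ⬝ᵥ ((pairField dWaveFormFactor L)ᴴ * pairField dWaveFormFactor L) *ᵥ φ).re ≤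
          c * (L : ℝ) ^ 4 :=
  thermalShellWitness U δ (by linarith [hδ.1]) c hc

end Witness

end Summit.HubbardSuperconductivity.HubbardSuperconductivity.Theorems.KkBandLift.Negative

end
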